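import Summits.HubbardSuperconductivity.HubbardSuperconductivity.Theorems.BalabanIRBirComplexStableXYRConvexityRadius
import HarnessLib

/-!
# Crux `BirComplexStableXYR` (stmt-HubbardSuperconductivity-14845): the window vertex beyond its
# quadratic Taylor polynomial is cubically small in the oscillation ("bounded phase")

Support file (prover seat 0, route BalabanIR) for the restated engine
`…Theses.BalabanIR.BirComplexStableXYR`.  For a finite Fourier table `c` with (U1) (charge-neutral
support) and (N) (`Σ c_n = 0`), and a window configuration `φ` oscillating by at most `δ`,

  `‖F(φ) - Σ_n c_n (i n·φ - (n·φ)²/2)‖ ≤ 2 · normA(c) · δ³`      (`cvxr_norm_genF_sub_taylor2_le`),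

with `normA` the `e^{|n|₁}`-weighted norm of hypothesis (A).  Ingredients: the global remainder bound
`‖e^{ix} - (1 + ix - x²/2)‖ ≤ |x|³/3` (`cvxr_norm_cexp_sub_taylor2_le`), the (U1) pairing bound
`|n·φ| ≤ |n|₁ δ` (`cvxr_abs_frq_le`) and `|n|₁³ ≤ 6 e^{|n|₁}`.  This is the size estimate of the
REGROUPED window vertex `u_s = K·[F_s - (quadratic Taylor polynomial at constants)]` of idea cards
`Cruxes/BirComplexStableXYR/Ideas/log-concave-core-bounded-phase.md` (there with `δ = 3r·K^{-2/5}`,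
giving `|u_s| ≤ 54 r³ B K^{-1/5}`) and `…/real-covariance-multiscale-port.md` (small-field vertices):
after summing over translates the linear term drops out by (U1) and the imaginary quadratic term by
(R)∧(P) (`Theorems.BirComplexStableXYR.Negative.quadForm_eq_zero_of_odd_even`), so what is bounded
here is the entire non-Gaussian content of a window — real anharmonicity and phase alike. [folklore]
-/

noncomputable section

namespace Summit.HubbardSuperconductivity.HubbardSuperconductivity.Theorems

open scoped BigOperators
open Summit.HubbardSuperconductivity.BirComplexStableXYNegative

section BoundedPhase

variable {r : ℕ}

/-! ### The cubic Taylor remainder of the window vertex ("bounded phase") -/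

/-- `‖e^{ix} - (1 + ix - x²/2)‖ ≤ |x|³/3` for real `x` (real part from
`0 ≤ x²/2 - (1 - cos x) ≤ x⁴/24` and the case distinction `|x| ≤ 4`, imaginary part from Mathlib's
`|x - sin x| ≤ |x|³/6`). [folklore] -/
theorem cvxr_norm_cexp_sub_taylor2_le (x : ℝ) :
    ‖Complex.exp (Complex.I * (x : ℂ)) - (1 + Complex.I * (x : ℂ) - (((x ^ 2 / 2 : ℝ)) : ℂ))‖ ≤
      |x| ^ 3 / 3 := by
  set R := Complex.exp (Complex.I * (x : ℂ)) - (1 + Complex.I * (x : ℂ) - (((x ^ 2 / 2 : ℝ)) : ℂ))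
    with hR
  have hre : R.re = Real.cos x - 1 + x ^ 2 / 2 := by
    rw [hR, Complex.sub_re, Complex.exp_re]
    simp [sq]
    ring
  have him : R.im = Real.sin x - x := by
    rw [hR, Complex.sub_im, Complex.exp_im]
    simp [sq]
  obtain ⟨hg0, hg1⟩ := cvxr_taylorGap_mem x
  have hx3 : 0 ≤ |x| ^ 3 := by positivity
  -- real part
  have hre_bd : |R.re| ≤ |x| ^ 3 / 6 := by
    rw [hre, abs_of_nonneg (by linarith)]
    rcases le_or_gt |x| 4 with h4 | h4
    · have hx4 : x ^ 4 = |x| * |x| ^ 3 := by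
        have : |x| ^ 4 = x ^ 4 := by rw [pow_abs]; exact abs_of_nonneg (by positivity)
        nlinarith [this]
      calc Real.cos x - 1 + x ^ 2 / 2 ≤ x ^ 4 / 24 := by linarith
        _ = |x| * |x| ^ 3 / 24 := by rw [hx4]
        _ ≤ 4 * |x| ^ 3 / 24 := by gcongr
        _ = |x| ^ 3 / 6 := by ring
    · have hx2 : x ^ 2 = |x| ^ 2 := (sq_abs x).symm
      have hcos := Real.cos_le_one x
      calc Real.cos x - 1 + x ^ 2 / 2 ≤ |x| ^ 2 / 2 := by rw [← hx2]; linarith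
        _ ≤ |x| * |x| ^ 2 / 8 := by nlinarith [sq_nonneg (|x|)]
        _ = |x| ^ 3 / 8 := by ring
        _ ≤ |x| ^ 3 / 6 := by linarith
  -- imaginary part
  have him_bd : |R.im| ≤ |x| ^ 3 / 6 := by
    rw [him, abs_sub_comm]
    exact Real.abs_sub_sin_le x
  calc ‖R‖ ≤ |R.re| + |R.im| := Complex.norm_le_abs_re_add_abs_im R
    _ ≤ |x| ^ 3 / 6 + |x| ^ 3 / 6 := add_le_add hre_bd him_bd
    _ = |x| ^ 3 / 3 := by ring

/-- **Bounded phase: the cubic Taylor remainder of the window vertex.**  For a table with (U1) and (N)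
and a configuration `φ` of oscillation `≤ δ` (`δ ≥ 0`),
`‖F(φ) - Σ_n c_n (i n·φ - (n·φ)²/2)‖ ≤ 2 · normA(c) · δ³`:
by (N) the constant Taylor term vanishes, by (U1) `|n·φ| ≤ |n|₁ δ`, and `|n|₁³ ≤ 6 e^{|n|₁}` is
absorbed into the weighted norm (A).  (After summing over translates the linear term vanishes by (U1)
and the imaginary quadratic term by (R)∧(P) — `Negative.quadForm_eq_zero_of_odd_even` — so this is the
whole non-Gaussian window vertex of the idea cards, real anharmonicity and phase alike.) [folklore] -/
theorem cvxr_norm_genF_sub_taylor2_le (c : Table r) (hU1 : ∀ n ∈ c.support, ∑ w, n w = 0)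
    (hN : c.sum (fun _ a => a) = 0) (φ : W r → ℝ) {δ : ℝ} (hδ0 : 0 ≤ δ)
    (hφ : ∀ w w', |φ w - φ w'| ≤ δ) :
    ‖genF c φ - c.sum (fun n a => a * (Complex.I * ((∑ w, (n w : ℝ) * φ w : ℝ) : ℂ) -
        (((∑ w, (n w : ℝ) * φ w) ^ 2 / 2 : ℝ) : ℂ)))‖ ≤ 2 * normA c * δ ^ 3 := by
  classical
  -- subtract the vanishing constant term (N)
  have hgen : genF c φ - c.sum (fun n a => a * (Complex.I * ((∑ w, (n w : ℝ) * φ w : ℝ) : ℂ) -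
      (((∑ w, (n w : ℝ) * φ w) ^ 2 / 2 : ℝ) : ℂ))) =
      ∑ n ∈ c.support, c n * (Complex.exp (Complex.I * ((∑ w, (n w : ℝ) * φ w : ℝ) : ℂ)) -
        (1 + Complex.I * ((∑ w, (n w : ℝ) * φ w : ℝ) : ℂ) -
          (((∑ w, (n w : ℝ) * φ w) ^ 2 / 2 : ℝ) : ℂ))) := by
    have hN' : ∑ n ∈ c.support, c n = 0 := hN
    unfold genF Finsupp.sum
    rw [← Finset.sum_sub_distrib, ← sub_zero (∑ n ∈ c.support, _ ), ← hN', ← Finset.sum_sub_distrib]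
    exact Finset.sum_congr rfl fun n _ => by ring
  rw [hgen]
  have hpt : ∀ n ∈ c.support,
      ‖c n * (Complex.exp (Complex.I * ((∑ w, (n w : ℝ) * φ w : ℝ) : ℂ)) -
        (1 + Complex.I * ((∑ w, (n w : ℝ) * φ w : ℝ) : ℂ) -
          (((∑ w, (n w : ℝ) * φ w) ^ 2 / 2 : ℝ) : ℂ)))‖ ≤
        ‖c n‖ * Real.exp (∑ w, |(n w : ℝ)|) * (2 * δ ^ 3) := by
    intro n hn
    set N1 : ℝ := ∑ w, |(n w : ℝ)| with hN1
    have hN1 : 0 ≤ N1 := Finset.sum_nonneg fun _ _ => abs_nonneg _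
    have hx : |∑ w, (n w : ℝ) * φ w| ≤ N1 * δ := cvxr_abs_frq_le n (hU1 n hn) φ hφ
    have hcube : N1 ^ 3 ≤ 6 * Real.exp N1 := by
      have h := Real.pow_div_factorial_le_exp N1 hN1 3
      norm_num [Nat.factorial] at h
      linarith
    rw [norm_mul]
    refine (mul_le_mul_of_nonneg_left (cvxr_norm_cexp_sub_taylor2_le _) (norm_nonneg _)).trans ?_
    have h3 : |∑ w, (n w : ℝ) * φ w| ^ 3 ≤ (N1 * δ) ^ 3 := pow_le_pow_left₀ (abs_nonneg _) hx 3
    calc ‖c n‖ * (|∑ w, (n w : ℝ) * φ w| ^ 3 / 3) ≤ ‖c n‖ * ((N1 * δ) ^ 3 / 3) := by gcongr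
      _ = ‖c n‖ * N1 ^ 3 * (δ ^ 3 / 3) := by ring
      _ ≤ ‖c n‖ * (6 * Real.exp N1) * (δ ^ 3 / 3) := by gcongr
      _ = ‖c n‖ * Real.exp N1 * (2 * δ ^ 3) := by ring
  calc ‖∑ n ∈ c.support, c n * (Complex.exp (Complex.I * ((∑ w, (n w : ℝ) * φ w : ℝ) : ℂ)) -
        (1 + Complex.I * ((∑ w, (n w : ℝ) * φ w : ℝ) : ℂ) -
          (((∑ w, (n w : ℝ) * φ w) ^ 2 / 2 : ℝ) : ℂ)))‖
      ≤ ∑ n ∈ c.support, ‖c n * (Complex.exp (Complex.I * ((∑ w, (n w : ℝ) * φ w : ℝ) : ℂ)) -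
        (1 + Complex.I * ((∑ w, (n w : ℝ) * φ w : ℝ) : ℂ) -
          (((∑ w, (n w : ℝ) * φ w) ^ 2 / 2 : ℝ) : ℂ)))‖ := norm_sum_le _ _
    _ ≤ ∑ n ∈ c.support, ‖c n‖ * Real.exp (∑ w, |(n w : ℝ)|) * (2 * δ ^ 3) := Finset.sum_le_sum hpt
    _ = 2 * normA c * δ ^ 3 := by
        unfold normA Finsupp.sum
        rw [← Finset.sum_mul]; ring

end BoundedPhase

end Summit.HubbardSuperconductivity.HubbardSuperconductivity.Theorems
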